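import Summits.RiemannHypothesis.RiemannHypothesis.Theorems.WeilGroundStateGroundStatesConvergeToXiStubDoobPrime
import Summits.RiemannHypothesis.RiemannHypothesis.Theorems.WeilGroundStateGroundStatesConvergeToXiStubArchBombieriTruncation
import Literature.NumberTheory.LFunctions.WeilExplicit
import Literature.NumberTheory.LFunctions.WeilMarkovQuadratic
import HarnessLib

/-!
# `WeilGroundState.GroundStatesConvergeToXi` — the archimedean term of `(Φw) ⋆ (Φw)~` through jump energies
(crux item stmt-RiemannHypothesis-1527, route route-RiemannHypothesis-WeilGroundState; line `Sketch`,
stub `stub_doob_arch` (D2); `--supports`)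

Dictionary (inline, no definitions): `Φ(t) = 2Ψ(2t)` is Riemann's kernel (real form
`2 * LagariasMontague.Psi (2 * t)`, complex form `(2 : ℂ) * LagariasMontague.Psic (2 * t)`); for a
test function `w`, `u = Φ·w`, `k = u ⋆ ũ = weilConv u (weilReflect u)`, `g_w(x) = Φ(x) ‖w x‖²`, the
`Φ`-weighted jump energy `I_w(h) = ∫ Φ(t) Φ(t+h) ‖w(t+h) − w(t)‖² dt`, the archimedean jump density
`ρ(h) = e^{h/2}/(2 sinh h)`, the translate `τ_xΦ = Φ(· + x)` and Bombieri's integrand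
`B_x(h) = (e^{h/2}(Φ(h+x) + Φ(−h+x)) − 2Φ(x))/(2 sinh h)` of `τ_xΦ`
(`weilArchTermBombieri (τ_xΦ) = −(log 4π + γ) Φ(x) − ∫₀^∞ B_x`).

* POINTWISE (`doobA_pointwise`): by the polarised increment of `…StubDoobPrime`
  (`2‖u‖₂² − D_h(u) = ⟨g_w, Φ(h+·) + Φ(−h+·)⟩ − I_w(h)`, `doobP_increment`) and `k(0) = ‖u‖₂² = ⟨g_w, Φ⟩`,
  Bombieri's integrand of `k` is `(e^{h/2}(k(h) + k(−h)) − 2k(0))/(2 sinh h) = ∫ g_w(x) B_x(h) dx − ρ(h) I_w(h)`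
  for every `h`.
* UNIFORM BOUND (`doobA_norm_integrand_le`): `‖B_x(h)‖ ≤ C e^{−h/2}` for all `x` and `h > 0`
  (near `0` the numerator is `≤ (2‖Φ‖_∞ + 2 Lip Φ) h` — `|e^{h/2} − 1| ≤ h` and the Lipschitz bound
  of `Φ` — and `sinh h ≥ h`; for `h ≥ 1`, `abTrunc_norm_integrand_le`).  Hence
  `(h, x) ↦ g_w(x) B_x(h)` is integrable on `(0, ∞) × ℝ` (majorant `C e^{−h/2} |g_w(x)|`), Fubini
  applies, and `ρ I_w = ∫ g_w B_·(h) − (Bombieri's integrand of k)` is integrable on `(0, ∞)`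
  (`integrableOn_bombieriIntegrand`).
* ASSEMBLY (`doobA_main`, for a general continuous bounded Lipschitz real weight `φ`; then `φ = Φ`
  by the double-exponential envelopes of `…PhiTail`):
  `weilArchTermBombieri k = ∫ g_w(x) · weilArchTermBombieri (τ_xΦ) dx + ∫₀^∞ ρ(h) I_w(h) dh`.

No new definitions; no named fact is used.
-/

noncomputable section

set_option linter.dupNamespace false

open scoped Topology Real ComplexConjugate
open Filter Set MeasureTheory Complex

namespace Summit.RiemannHypothesis.RiemannHypothesis.Theorems.GroundStatesConvergeToXi

open Literature.NumberTheory.LFunctions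

/-! ## Bombieri's integrand of a translate: a bound uniform in the translation -/

/-- The numerator `e^{h/2}(φ(h+x) + φ(−h+x)) − 2φ(x)` of Bombieri's integrand of `φ(· + x)` is
`≤ (2K₀ + 2K₁) h` on `h ∈ [0, 1]`, uniformly in `x`, for `|φ| ≤ K₀` and `φ` `K₁`-Lipschitz
(`|e^{h/2} − 1| ≤ h`). [folklore] -/
theorem doobA_norm_numerator_le {φ : ℝ → ℝ} {K₀ K₁ : ℝ} (hK₀ : ∀ t, |φ t| ≤ K₀)
    (hK₁ : ∀ s t, |φ s - φ t| ≤ K₁ * |s - t|) (x : ℝ) {h : ℝ} (hh : h ∈ Icc (0 : ℝ) 1) :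
    ‖(Real.exp (h / 2) : ℂ) * ((φ (h + x) : ℂ) + (φ (-h + x) : ℂ)) - 2 * (φ (0 + x) : ℂ)‖ ≤
      (2 * K₀ + 2 * K₁) * h := by
  have hcast : (Real.exp (h / 2) : ℂ) * ((φ (h + x) : ℂ) + (φ (-h + x) : ℂ)) - 2 * (φ (0 + x) : ℂ) =
      ((Real.exp (h / 2) * (φ (h + x) + φ (-h + x)) - 2 * φ (0 + x) : ℝ) : ℂ) := by
    push_cast
    ring
  rw [hcast, Complex.norm_real, Real.norm_eq_abs]
  have hh2 : |h / 2| ≤ 1 := by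
    rw [abs_of_nonneg (by linarith [hh.1])]
    linarith [hh.2]
  have he : |Real.exp (h / 2) - 1| ≤ h := by
    have h1 := Real.abs_exp_sub_one_le hh2
    rw [abs_of_nonneg (by linarith [hh.1] : (0 : ℝ) ≤ h / 2)] at h1
    linarith
  have h1 : |φ (h + x) - φ (0 + x)| ≤ K₁ * h := by
    have h1 := hK₁ (h + x) (0 + x)
    rwa [show h + x - (0 + x) = h by ring, abs_of_nonneg hh.1] at h1
  have h2 : |φ (-h + x) - φ (0 + x)| ≤ K₁ * h := by
    have h2 := hK₁ (-h + x) (0 + x)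
    rwa [show -h + x - (0 + x) = -h by ring, abs_neg, abs_of_nonneg hh.1] at h2
  have h3 : |φ (h + x) + φ (-h + x)| ≤ K₀ + K₀ :=
    (abs_add_le _ _).trans (add_le_add (hK₀ _) (hK₀ _))
  have key : Real.exp (h / 2) * (φ (h + x) + φ (-h + x)) - 2 * φ (0 + x) =
      (Real.exp (h / 2) - 1) * (φ (h + x) + φ (-h + x)) +
        ((φ (h + x) - φ (0 + x)) + (φ (-h + x) - φ (0 + x))) := by ring
  rw [key]
  calc |(Real.exp (h / 2) - 1) * (φ (h + x) + φ (-h + x)) +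
        ((φ (h + x) - φ (0 + x)) + (φ (-h + x) - φ (0 + x)))|
      ≤ |Real.exp (h / 2) - 1| * |φ (h + x) + φ (-h + x)| +
        (|φ (h + x) - φ (0 + x)| + |φ (-h + x) - φ (0 + x)|) :=
        (abs_add_le _ _).trans (add_le_add (abs_mul _ _).le (abs_add_le _ _))
    _ ≤ h * (K₀ + K₀) + (K₁ * h + K₁ * h) :=
        add_le_add (mul_le_mul he h3 (abs_nonneg _) hh.1) (add_le_add h1 h2)
    _ = (2 * K₀ + 2 * K₁) * h := by ring

/-- **Uniform bound for Bombieri's integrand of the translates `φ(· + x)`**: for `|φ| ≤ K₀`, `φ`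
`K₁`-Lipschitz, every `x` and every `h > 0`,
`‖(e^{h/2}(φ(h+x) + φ(−h+x)) − 2φ(x))/(2 sinh h)‖ ≤ ((K₀ + K₁)e^{1/2} + 8K₀) e^{−h/2}`
(`sinh h ≥ h` on `(0, 1]`, `abTrunc_norm_integrand_le` on `[1, ∞)`). [folklore] -/
theorem doobA_norm_integrand_le {φ : ℝ → ℝ} {K₀ K₁ : ℝ} (hK₀ : ∀ t, |φ t| ≤ K₀)
    (hK₁ : ∀ s t, |φ s - φ t| ≤ K₁ * |s - t|) (hK1 : 0 ≤ K₁) (x : ℝ) {h : ℝ} (hh : 0 < h) :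
    ‖((Real.exp (h / 2) : ℂ) * ((φ (h + x) : ℂ) + (φ (-h + x) : ℂ)) - 2 * (φ (0 + x) : ℂ)) /
        (2 * Real.sinh h : ℂ)‖ ≤
      ((K₀ + K₁) * Real.exp (1 / 2) + 8 * K₀) * Real.exp (-(1 / 2) * h) := by
  have hK0 : 0 ≤ K₀ := (abs_nonneg _).trans (hK₀ 0)
  rcases le_or_gt h 1 with hh1 | hh1
  · have hsinh : 0 < Real.sinh h := Real.sinh_pos_iff.2 hh
    have h2s : 0 < 2 * Real.sinh h := by positivity
    rw [norm_div, abTrunc_norm_two_mul_sinh hh, div_le_iff₀ h2s]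
    have e1 : 1 ≤ Real.exp (1 / 2) * Real.exp (-(1 / 2) * h) := by
      rw [← Real.exp_add]
      exact Real.one_le_exp (by linarith)
    have e2 : h ≤ Real.sinh h := Real.self_le_sinh_iff.2 hh.le
    calc ‖(Real.exp (h / 2) : ℂ) * ((φ (h + x) : ℂ) + (φ (-h + x) : ℂ)) - 2 * (φ (0 + x) : ℂ)‖
        ≤ (2 * K₀ + 2 * K₁) * h := doobA_norm_numerator_le hK₀ hK₁ x ⟨hh.le, hh1⟩
      _ ≤ (2 * K₀ + 2 * K₁) * Real.sinh h := by gcongr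
      _ ≤ (2 * K₀ + 2 * K₁) * Real.sinh h * (Real.exp (1 / 2) * Real.exp (-(1 / 2) * h)) :=
          le_mul_of_one_le_right (by positivity) e1
      _ = (K₀ + K₁) * Real.exp (1 / 2) * Real.exp (-(1 / 2) * h) * (2 * Real.sinh h) := by ring
      _ ≤ ((K₀ + K₁) * Real.exp (1 / 2) + 8 * K₀) * Real.exp (-(1 / 2) * h) *
            (2 * Real.sinh h) := by
          gcongr
          linarith [mul_nonneg (by norm_num : (0 : ℝ) ≤ 8) hK0]
  · have hb : ∀ t, ‖((φ (t + x) : ℝ) : ℂ)‖ ≤ K₀ := fun t => by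
      rw [Complex.norm_real, Real.norm_eq_abs]
      exact hK₀ _
    have hA := abTrunc_norm_integrand_le (g := fun t : ℝ => ((φ (t + x) : ℝ) : ℂ)) (t := h) hb hh1.le
    calc ‖((Real.exp (h / 2) : ℂ) * ((φ (h + x) : ℂ) + (φ (-h + x) : ℂ)) - 2 * (φ (0 + x) : ℂ)) /
          (2 * Real.sinh h : ℂ)‖ ≤ 8 * K₀ * Real.exp (-(1 / 2) * h) := hA
      _ ≤ ((K₀ + K₁) * Real.exp (1 / 2) + 8 * K₀) * Real.exp (-(1 / 2) * h) := by
          gcongr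
          have : 0 ≤ (K₀ + K₁) * Real.exp (1 / 2) := by positivity
          linarith

/-- **Joint integrability.** For a continuous `φ` with `|φ| ≤ K₀`, `K₁`-Lipschitz, and a test
function `w`, `(h, x) ↦ φ(x)‖w x‖² · B_x(h)` is integrable on `(0, ∞) × ℝ` (majorant
`C e^{−h/2} · |φ(x)|‖w x‖²`, `doobA_norm_integrand_le`). [folklore] -/
theorem doobA_integrable_prod {φ : ℝ → ℝ} (hφc : Continuous φ) {K₀ K₁ : ℝ}
    (hK₀ : ∀ t, |φ t| ≤ K₀) (hK₁ : ∀ s t, |φ s - φ t| ≤ K₁ * |s - t|) (hK1 : 0 ≤ K₁)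
    {w : ℝ → ℂ} (hw : IsWeilTest w) :
    Integrable (fun z : ℝ × ℝ => ((φ z.2 * ‖w z.2‖ ^ 2 : ℝ) : ℂ) *
      (((Real.exp (z.1 / 2) : ℂ) * ((φ (z.1 + z.2) : ℂ) + (φ (-z.1 + z.2) : ℂ)) -
          2 * (φ (0 + z.2) : ℂ)) / (2 * Real.sinh z.1 : ℂ)))
      ((volume.restrict (Ioi (0 : ℝ))).prod volume) := by
  set C : ℝ := (K₀ + K₁) * Real.exp (1 / 2) + 8 * K₀ with hC
  have hwc : Continuous w := hw.1.continuous
  have hg : Integrable fun x : ℝ => φ x * ‖w x‖ ^ 2 :=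
    doobP_integrable_mul hφc hK₀ hw.integrable_norm_sq
  have hdom : Integrable (fun z : ℝ × ℝ => C * Real.exp (-(1 / 2) * z.1) * ‖φ z.2 * ‖w z.2‖ ^ 2‖)
      ((volume.restrict (Ioi (0 : ℝ))).prod volume) :=
    ((exp_neg_integrableOn_Ioi 0 (by norm_num : (0 : ℝ) < 1 / 2)).const_mul C).mul_prod hg.norm
  refine hdom.mono' ?_ ?_
  · refine (Measurable.mul ?_ (Measurable.div ?_ ?_)).aestronglyMeasurable
    · exact (by fun_prop : Continuous fun z : ℝ × ℝ => ((φ z.2 * ‖w z.2‖ ^ 2 : ℝ) : ℂ)).measurable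
    · exact (by fun_prop : Continuous fun z : ℝ × ℝ => (Real.exp (z.1 / 2) : ℂ) *
        ((φ (z.1 + z.2) : ℂ) + (φ (-z.1 + z.2) : ℂ)) - 2 * (φ (0 + z.2) : ℂ)).measurable
    · exact (by fun_prop : Continuous fun z : ℝ × ℝ => (2 * Real.sinh z.1 : ℂ)).measurable
  · rw [Measure.restrict_prod_eq_prod_univ,
      ae_restrict_iff' (measurableSet_Ioi.prod MeasurableSet.univ)]
    refine ae_of_all _ fun z hz => ?_
    have hz1 : 0 < z.1 := hz.1
    rw [norm_mul, Complex.norm_real]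
    calc ‖φ z.2 * ‖w z.2‖ ^ 2‖ * ‖((Real.exp (z.1 / 2) : ℂ) *
          ((φ (z.1 + z.2) : ℂ) + (φ (-z.1 + z.2) : ℂ)) - 2 * (φ (0 + z.2) : ℂ)) /
            (2 * Real.sinh z.1 : ℂ)‖
        ≤ ‖φ z.2 * ‖w z.2‖ ^ 2‖ * (C * Real.exp (-(1 / 2) * z.1)) :=
          mul_le_mul_of_nonneg_left (doobA_norm_integrand_le hK₀ hK₁ hK1 z.2 hz1) (norm_nonneg _)
      _ = C * Real.exp (-(1 / 2) * z.1) * ‖φ z.2 * ‖w z.2‖ ^ 2‖ := mul_comm _ _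

/-! ## Bombieri's integrand of `k = u ⋆ ũ`, `u = φ·w`, pointwise -/

/-- `‖u‖₂² = ∫ φ(x)‖w x‖² φ(x) dx` for `u = φ·w`. [folklore] -/
theorem doobA_norm_sq {φ : ℝ → ℝ} {w u : ℝ → ℂ} (hu : ∀ t, u t = (φ t : ℂ) * w t) :
    (∫ x : ℝ, ‖u x‖ ^ 2) = ∫ x : ℝ, φ x * ‖w x‖ ^ 2 * φ (0 + x) := by
  refine integral_congr_ae (ae_of_all _ fun x => ?_)
  beta_reduce
  rw [hu, norm_mul, Complex.norm_real, Real.norm_eq_abs, mul_pow, sq_abs, zero_add]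
  ring

/-- **Bombieri's integrand of `k = u ⋆ ũ` through the weighted jump energy**, pointwise in `h`:
`(e^{h/2}(k(h) + k(−h)) − 2k(0))/(2 sinh h) = ∫ φ(x)‖w x‖² B_x(h) dx − ρ(h) I(h)` with
`I(h) = ∫ φ(x)φ(x+h)‖w(x+h) − w(x)‖² dx`, `ρ(h) = e^{h/2}/(2 sinh h)`
(`weilConv_weilReflect_add_neg`, `doobP_increment`, `k(0) = ‖u‖₂²`, linearity). [folklore] -/
theorem doobA_pointwise {φ : ℝ → ℝ} (hφc : Continuous φ) {K₀ : ℝ} (hK₀ : ∀ t, |φ t| ≤ K₀)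
    {w u : ℝ → ℂ} (hw : IsWeilTest w) (huT : IsWeilTest u) (hu : ∀ t, u t = (φ t : ℂ) * w t)
    (h : ℝ) :
    ((Real.exp (h / 2) : ℂ) * (weilConv u (weilReflect u) h + weilConv u (weilReflect u) (-h)) -
        2 * weilConv u (weilReflect u) 0) / (2 * Real.sinh h : ℂ) =
      (∫ x : ℝ, ((φ x * ‖w x‖ ^ 2 : ℝ) : ℂ) *
        (((Real.exp (h / 2) : ℂ) * ((φ (h + x) : ℂ) + (φ (-h + x) : ℂ)) - 2 * (φ (0 + x) : ℂ)) /
          (2 * Real.sinh h : ℂ))) -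
      ((Real.exp (h / 2) / (2 * Real.sinh h) *
        ∫ x : ℝ, φ x * φ (x + h) * ‖w (x + h) - w x‖ ^ 2 : ℝ) : ℂ) := by
  have hg : Integrable fun x : ℝ => φ x * ‖w x‖ ^ 2 :=
    doobP_integrable_mul hφc hK₀ hw.integrable_norm_sq
  have hJ : Integrable fun x : ℝ => φ x * ‖w x‖ ^ 2 * (φ (h + x) + φ (-h + x)) :=
    doobP_integrable_mul' hg (by fun_prop)
      (fun x => (abs_add_le _ _).trans (add_le_add (hK₀ _) (hK₀ _)))
  have hN : Integrable fun x : ℝ => φ x * ‖w x‖ ^ 2 * φ (0 + x) :=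
    doobP_integrable_mul' hg (by fun_prop) (fun x => hK₀ _)
  have hcast : ∀ x : ℝ, ((φ x * ‖w x‖ ^ 2 : ℝ) : ℂ) *
      (((Real.exp (h / 2) : ℂ) * ((φ (h + x) : ℂ) + (φ (-h + x) : ℂ)) - 2 * (φ (0 + x) : ℂ)) /
        (2 * Real.sinh h : ℂ)) =
      (((Real.exp (h / 2) * (φ x * ‖w x‖ ^ 2 * (φ (h + x) + φ (-h + x))) -
        2 * (φ x * ‖w x‖ ^ 2 * φ (0 + x))) / (2 * Real.sinh h) : ℝ) : ℂ) := by
    intro x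
    push_cast
    ring
  simp_rw [hcast]
  rw [integral_complex_ofReal, weilConv_weilReflect_add_neg huT, weilConv_weilReflect_apply_zero,
    doobP_increment hφc hK₀ hw hu h, doobA_norm_sq hu, integral_div,
    integral_sub (hJ.const_mul _) (hN.const_mul _), integral_const_mul, integral_const_mul]
  push_cast
  ring

/-! ## The archimedean term of `k = u ⋆ ũ` for a general weight -/

/-- **The Doob archimedean identity for a general weight.**  For a continuous real `φ` with
`|φ| ≤ K₀`, `φ` `K₁`-Lipschitz, a test function `w` and a test function `u = φ·w`, with
`g(x) = φ(x)‖w x‖²`, `I(h) = ∫ φ(t)φ(t+h)‖w(t+h) − w(t)‖² dt`, `ρ(h) = e^{h/2}/(2 sinh h)`: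
`ρ I` is integrable on `(0, ∞)`, `g · weilArchTermBombieri (φ(· + x))` is integrable, and
`weilArchTermBombieri (u ⋆ ũ) = ∫ g(x) weilArchTermBombieri (φ(· + x)) dx + ∫₀^∞ ρ I`
(`doobA_pointwise` integrated over `(0, ∞)`; Fubini for `(h, x) ↦ g(x) B_x(h)` by
`doobA_integrable_prod`). [folklore] -/
theorem doobA_main {φ : ℝ → ℝ} (hφc : Continuous φ) {K₀ K₁ : ℝ} (hK₀ : ∀ t, |φ t| ≤ K₀)
    (hK₁ : ∀ s t, |φ s - φ t| ≤ K₁ * |s - t|) (hK1 : 0 ≤ K₁)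
    {w u : ℝ → ℂ} (hw : IsWeilTest w) (huT : IsWeilTest u) (hu : ∀ t, u t = (φ t : ℂ) * w t) :
    IntegrableOn (fun h : ℝ => Real.exp (h / 2) / (2 * Real.sinh h) *
        ∫ t : ℝ, φ t * φ (t + h) * ‖w (t + h) - w t‖ ^ 2) (Ioi 0) ∧
    Integrable (fun x : ℝ => ((φ x * ‖w x‖ ^ 2 : ℝ) : ℂ) *
        weilArchTermBombieri (fun t : ℝ => (φ (t + x) : ℂ))) ∧
    weilArchTermBombieri (weilConv u (weilReflect u)) =
      (∫ x : ℝ, ((φ x * ‖w x‖ ^ 2 : ℝ) : ℂ) *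
          weilArchTermBombieri (fun t : ℝ => (φ (t + x) : ℂ))) +
        ((∫ h in Ioi (0 : ℝ), Real.exp (h / 2) / (2 * Real.sinh h) *
          ∫ t : ℝ, φ t * φ (t + h) * ‖w (t + h) - w t‖ ^ 2 : ℝ) : ℂ) := by
  -- the joint integrand `F h x = g(x) B_x(h)`, kept opaque
  obtain ⟨F, hF⟩ : ∃ F : ℝ → ℝ → ℂ, F = fun h x => ((φ x * ‖w x‖ ^ 2 : ℝ) : ℂ) *
      (((Real.exp (h / 2) : ℂ) * ((φ (h + x) : ℂ) + (φ (-h + x) : ℂ)) - 2 * (φ (0 + x) : ℂ)) /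
        (2 * Real.sinh h : ℂ)) := ⟨_, rfl⟩
  have hF' : ∀ h x, F h x = ((φ x * ‖w x‖ ^ 2 : ℝ) : ℂ) *
      (((Real.exp (h / 2) : ℂ) * ((φ (h + x) : ℂ) + (φ (-h + x) : ℂ)) - 2 * (φ (0 + x) : ℂ)) /
        (2 * Real.sinh h : ℂ)) := fun h x => by rw [hF]
  have hg : Integrable fun x : ℝ => φ x * ‖w x‖ ^ 2 :=
    doobP_integrable_mul hφc hK₀ hw.integrable_norm_sq
  have hN : Integrable fun x : ℝ => φ x * ‖w x‖ ^ 2 * φ (0 + x) :=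
    doobP_integrable_mul' hg (by fun_prop) (fun x => hK₀ _)
  -- Fubini
  have hFi : Integrable (Function.uncurry F) ((volume.restrict (Ioi (0 : ℝ))).prod volume) := by
    rw [hF]
    exact doobA_integrable_prod hφc hK₀ hK₁ hK1 hw
  have hswap : ∫ h in Ioi (0 : ℝ), ∫ x : ℝ, F h x = ∫ x : ℝ, ∫ h in Ioi (0 : ℝ), F h x :=
    integral_integral_swap hFi
  have hIh : Integrable (fun h : ℝ => ∫ x : ℝ, F h x) (volume.restrict (Ioi (0 : ℝ))) :=
    hFi.integral_prod_left
  have hIx : Integrable (fun x : ℝ => ∫ h in Ioi (0 : ℝ), F h x) := hFi.integral_prod_right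
  -- Bombieri's integrand of `k`, pointwise and integrated
  have hkT : IsWeilTest (weilConv u (weilReflect u)) := huT.weilConv huT.weilReflect
  have hB := integrableOn_bombieriIntegrand hkT
  have hpt : ∀ h : ℝ, ((Real.exp (h / 2) : ℂ) *
      (weilConv u (weilReflect u) h + weilConv u (weilReflect u) (-h)) -
        2 * weilConv u (weilReflect u) 0) / (2 * Real.sinh h : ℂ) =
      (∫ x : ℝ, F h x) - ((Real.exp (h / 2) / (2 * Real.sinh h) *
        ∫ x : ℝ, φ x * φ (x + h) * ‖w (x + h) - w x‖ ^ 2 : ℝ) : ℂ) := by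
    intro h
    simp_rw [hF']
    exact doobA_pointwise hφc hK₀ hw huT hu h
  -- (a) `ρ I` is integrable on `(0, ∞)`
  have h1 : Integrable (fun h : ℝ => ((Real.exp (h / 2) / (2 * Real.sinh h) *
      ∫ x : ℝ, φ x * φ (x + h) * ‖w (x + h) - w x‖ ^ 2 : ℝ) : ℂ)) (volume.restrict (Ioi (0 : ℝ))) := by
    refine (hIh.sub' hB).congr (ae_of_all _ fun h => ?_)
    beta_reduce
    rw [hpt h]
    ring
  have hρI : IntegrableOn (fun h : ℝ => Real.exp (h / 2) / (2 * Real.sinh h) *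
      ∫ t : ℝ, φ t * φ (t + h) * ‖w (t + h) - w t‖ ^ 2) (Ioi 0) := by
    refine h1.re.congr (ae_of_all _ fun h => ?_)
    simp only [RCLike.re_to_complex, Complex.ofReal_re]
  -- the killing piece `−L g φ`, with `Complex.ofReal` casts
  have hN' : Integrable (fun x : ℝ => -(Real.log (4 * π) + Real.eulerMascheroniConstant : ℂ) *
      ((φ x * ‖w x‖ ^ 2 * φ (0 + x) : ℝ) : ℂ)) := hN.ofReal.const_mul _
  -- (b) `g · weilArchTermBombieri (φ(· + x)) = −L g Φ − ∫₀^∞ F(·, x)`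
  have hgB : ∀ x : ℝ, ∫ h in Ioi (0 : ℝ), F h x = ((φ x * ‖w x‖ ^ 2 : ℝ) : ℂ) *
      ∫ h in Ioi (0 : ℝ), ((Real.exp (h / 2) : ℂ) * ((φ (h + x) : ℂ) + (φ (-h + x) : ℂ)) -
        2 * (φ (0 + x) : ℂ)) / (2 * Real.sinh h : ℂ) := by
    intro x
    simp_rw [hF']
    exact integral_const_mul _ _
  have hW : ∀ x : ℝ, ((φ x * ‖w x‖ ^ 2 : ℝ) : ℂ) *
      weilArchTermBombieri (fun t : ℝ => (φ (t + x) : ℂ)) =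
      -(Real.log (4 * π) + Real.eulerMascheroniConstant : ℂ) *
          ((φ x * ‖w x‖ ^ 2 * φ (0 + x) : ℝ) : ℂ) - ∫ h in Ioi (0 : ℝ), F h x := by
    intro x
    rw [hgB x, weilArchTermBombieri_eq]
    push_cast
    ring
  have h2 : Integrable (fun x : ℝ => ((φ x * ‖w x‖ ^ 2 : ℝ) : ℂ) *
      weilArchTermBombieri (fun t : ℝ => (φ (t + x) : ℂ))) := by
    exact (hN'.sub' hIx).congr (ae_of_all _ fun x => (hW x).symm)
  refine ⟨hρI, h2, ?_⟩
  -- (c) assembly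
  have hbk : ∫ h in Ioi (0 : ℝ), ((Real.exp (h / 2) : ℂ) *
      (weilConv u (weilReflect u) h + weilConv u (weilReflect u) (-h)) -
        2 * weilConv u (weilReflect u) 0) / (2 * Real.sinh h : ℂ) =
      (∫ h in Ioi (0 : ℝ), ∫ x : ℝ, F h x) - ∫ h in Ioi (0 : ℝ),
        ((Real.exp (h / 2) / (2 * Real.sinh h) *
          ∫ x : ℝ, φ x * φ (x + h) * ‖w (x + h) - w x‖ ^ 2 : ℝ) : ℂ) := by
    rw [← integral_sub hIh h1]
    exact integral_congr_ae (ae_of_all _ fun h => hpt h)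
  have hInt2 : (∫ x : ℝ, ((φ x * ‖w x‖ ^ 2 : ℝ) : ℂ) *
      weilArchTermBombieri (fun t : ℝ => (φ (t + x) : ℂ))) =
      -(Real.log (4 * π) + Real.eulerMascheroniConstant : ℂ) *
          ((∫ x : ℝ, φ x * ‖w x‖ ^ 2 * φ (0 + x) : ℝ) : ℂ) -
        ∫ x : ℝ, ∫ h in Ioi (0 : ℝ), F h x := by
    rw [integral_congr_ae (ae_of_all _ hW), integral_sub hN' hIx, integral_const_mul,
      integral_complex_ofReal]
  rw [hInt2, weilArchTermBombieri_eq (weilConv u (weilReflect u)), hbk, hswap,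
    weilConv_weilReflect_apply_zero, doobA_norm_sq hu, integral_complex_ofReal]
  ring

/-! ## Specialisation to Riemann's kernel `Φ(t) = 2Ψ(2t)` -/

/-- `|Φ| ≤ K₀` on `ℝ` (double-exponential envelope). [folklore] -/
theorem doobA_phi_bound : ∃ K₀ : ℝ, ∀ t : ℝ, |2 * LagariasMontague.Psi (2 * t)| ≤ K₀ := by
  obtain ⟨K, hK0, hK⟩ := doobP_exists_bound
  refine ⟨K, fun t => ?_⟩
  have h := hK t 0
  rw [add_zero, abs_zero, Real.exp_zero, mul_one] at h
  exact h.trans (mul_le_of_le_one_right hK0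
    (Real.exp_le_one_iff.mpr (neg_nonpos.mpr (abs_nonneg t))))

/-- **`Φ` is Lipschitz**: `|Φ(s) − Φ(t)| ≤ K₁ |s − t|` (mean value inequality with the
double-exponential envelope of `Φ' = 4Ψ'(2·)`, `exists_norm_dphi_le`). [folklore] -/
theorem doobA_phi_lipschitz : ∃ K₁ : ℝ, 0 ≤ K₁ ∧ ∀ s t : ℝ,
    |2 * LagariasMontague.Psi (2 * s) - 2 * LagariasMontague.Psi (2 * t)| ≤ K₁ * |s - t| := by
  obtain ⟨K₁, hK₁, h₁⟩ := exists_norm_dphi_le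
  refine ⟨K₁, hK₁, fun s t => ?_⟩
  have hb : ∀ x ∈ (univ : Set ℝ), ‖(4 : ℂ) * (LagariasMontague.thetaSeries
      (LagariasMontague.thetaδ LagariasMontague.psiPoly) (2 * x) : ℂ)‖ ≤ K₁ := fun x _ =>
    (h₁ x).trans (mul_le_of_le_one_right hK₁ ((phiTr_envelope_le x).trans
      (Real.exp_le_one_iff.mpr (neg_nonpos.mpr (abs_nonneg x)))))
  have hmv := convex_univ.norm_image_sub_le_of_norm_hasDerivWithin_le
    (fun x _ => (phi_hasDerivAt x).hasDerivWithinAt) hb (mem_univ t) (mem_univ s)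
  rw [doobP_phic, doobP_phic, ← Complex.ofReal_sub, Complex.norm_real, Real.norm_eq_abs,
    Real.norm_eq_abs] at hmv
  exact hmv

/-- **Stub D2 — `doob_arch` (RH-free).**  For a test function `w` and `u = Φ·w`, `k = u ⋆ ũ`:
Bombieri's archimedean term of `k` splits as
`weilArchTermBombieri k = ⟨g_w, x ↦ weilArchTermBombieri (τ_xΦ)⟩ + ∫₀^∞ e^{h/2}/(2 sinh h) I_w(h) dh`,
`I_w(h) = ∫ Φ(t)Φ(t+h)‖w(t+h) − w(t)‖² dt` the `Φ`-weighted jump energy (Doob transform): insert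
`k(h) + k(−h) = ⟨g_w, Φ(h+·) + Φ(−h+·)⟩ − I_w(h)` and `k(0) = ⟨g_w, Φ⟩` in Bombieri's integrand,
which becomes `∫ g_w(x) B_x(h) dx − ρ(h) I_w(h)` with `B_x` Bombieri's integrand of `τ_xΦ`;
`‖B_x(h)‖ ≤ C e^{−h/2}` uniformly in `x` gives Fubini on `(0, ∞) × ℝ` and the integrability of
`ρ I_w`. [folklore] -/
theorem stub_doob_arch :
    ∀ w : ℝ → ℂ, IsWeilTest w →
      IntegrableOn (fun h : ℝ => Real.exp (h / 2) / (2 * Real.sinh h) *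
        ∫ t : ℝ, 2 * LagariasMontague.Psi (2 * t) * (2 * LagariasMontague.Psi (2 * (t + h))) *
          ‖w (t + h) - w t‖ ^ 2) (Ioi 0) ∧
      Integrable (fun x : ℝ => ((2 * LagariasMontague.Psi (2 * x) * ‖w x‖ ^ 2 : ℝ) : ℂ) *
        weilArchTermBombieri (fun t : ℝ => (2 : ℂ) * LagariasMontague.Psic (2 * (t + x)))) ∧
      weilArchTermBombieri (weilConv (fun t : ℝ => (2 : ℂ) * LagariasMontague.Psic (2 * t) * w t)
          (weilReflect (fun t : ℝ => (2 : ℂ) * LagariasMontague.Psic (2 * t) * w t))) =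
        (∫ x : ℝ, ((2 * LagariasMontague.Psi (2 * x) * ‖w x‖ ^ 2 : ℝ) : ℂ) *
          weilArchTermBombieri (fun t : ℝ => (2 : ℂ) * LagariasMontague.Psic (2 * (t + x)))) +
        ((∫ h in Ioi (0 : ℝ), Real.exp (h / 2) / (2 * Real.sinh h) *
          ∫ t : ℝ, 2 * LagariasMontague.Psi (2 * t) * (2 * LagariasMontague.Psi (2 * (t + h))) *
            ‖w (t + h) - w t‖ ^ 2 : ℝ) : ℂ) := by
  intro w hw
  obtain ⟨K₀, hK₀⟩ := doobA_phi_bound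
  obtain ⟨K₁, hK1, hK₁⟩ := doobA_phi_lipschitz
  have hφc : Continuous fun t : ℝ => 2 * LagariasMontague.Psi (2 * t) :=
    continuous_const.mul ((LagariasMontague.continuous_thetaSeries _).comp
      (continuous_const.mul continuous_id))
  have hfun : (fun t : ℝ => (2 : ℂ) * LagariasMontague.Psic (2 * t) * w t) =
      fun t : ℝ => ((2 * LagariasMontague.Psi (2 * t) : ℝ) : ℂ) * w t :=
    funext fun t => by rw [doobP_phic]
  have huT : IsWeilTest (fun t : ℝ => ((2 * LagariasMontague.Psi (2 * t) : ℝ) : ℂ) * w t) :=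
    hfun ▸ ⟨contDiff_phi.mul hw.1, hw.2.mul_left⟩
  have main := doobA_main hφc hK₀ hK₁ hK1 hw huT (fun t => rfl)
  simp only [doobP_phic]
  exact main

end Summit.RiemannHypothesis.RiemannHypothesis.Theorems.GroundStatesConvergeToXi

end
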